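import Literature.NumberTheory.Transcendental.FormsAlgebraWedgeProofs
import Literature.Geometry.Kaehler.LocalFormsGlue
import Literature.LinearAlgebra.Alternating.WedgeOne

/-!
# The Leibniz rule `d(ρα) = ρ dα + dρ ∧ α` for a function times a form

For a real function `ρ` and a `k`-form `α` on a manifold (with corners, bare charted space — both
sides are computed in the chart at the point), differentiable at `x`:

* `extDerivWithin_fun_smul'` (flat): `d(g ω) = g dω + dg ∧ ω` within a set at a point of unique
  differentiability, with `dg ∧ ω = wedgeOne (fderivWithin g) ω` in the alternatization convention
  of Mathlib's `extDeriv` (`Literature.LinearAlgebra.Alternating.wedgeOne`);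
* `mextDeriv_fun_smul_apply` (manifold): `d(ρ • α) x = ρ x • dα x + (dρ)ₓ ∧ α x`, where
  `(dρ)ₓ = fderivWithin ℝ (ρ ∘ (extChartAt I x).symm) (range I) (extChartAt I x x)` is the
  differential of `ρ` read in the chart at `x` (on `TangentSpace I x = E`);
* `IsSmoothForm.fun_smul'`: `ρ • α` is smooth for smooth `ρ`, `α` (any coefficients `F`).

Warner (1983), Thm. 2.20 (d is an antiderivation; the case of a `0`-form `ρ`: `d(ρα) = dρ ∧ α +
ρ dα`), Prop. 2.23; Bott–Tu (1982), §I.1. These are the order-zero/first-order bookkeeping rules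
used to show that a natural first-order operator with vanishing symbol is `C^∞`-linear
(Voisin (2002), proof of Prop. 6.5).

## References

* F. W. Warner, *Foundations of Differentiable Manifolds and Lie Groups*, GTM 94 (1983), 2.20,
  2.23. [WarnerGTM94]
* C. Voisin, *Hodge Theory and Complex Algebraic Geometry I* (2002), §6.1.1. [Voisin2002]
-/

noncomputable section

open scoped Manifold ContDiff Topology
open Set ContinuousAlternatingMap Function
open Literature.LinearAlgebra.Alternating

namespace Literature.Geometry.Kaehler

/-! ### Flat: `d(g ω) = g dω + dg ∧ ω` -/

section Flat

variable {𝕜 : Type*} [NontriviallyNormedField 𝕜] {V : Type*} [NormedAddCommGroup V]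
  [NormedSpace 𝕜 V] {F : Type*} [NormedAddCommGroup F] [NormedSpace 𝕜 F] {k : ℕ}

/-- **Leibniz rule for a function times a form, flat and within a set**:
`d(g ω) = g dω + dg ∧ ω` at a point of unique differentiability, where `dg ∧ ω = wedgeOne (Dg) ω`
(`extDerivWithin = alternatizeUncurryFin ∘ fderivWithin` and the product rule for `fderivWithin`).
Warner (1983), Thm. 2.20. [cite: WarnerGTM94, Thm. 2.20] -/
theorem extDerivWithin_fun_smul' {g : V → 𝕜} {β : V → V [⋀^Fin k]→L[𝕜] F} {s : Set V} {x : V}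
    (hg : DifferentiableWithinAt 𝕜 g s x) (hβ : DifferentiableWithinAt 𝕜 β s x)
    (hs : UniqueDiffWithinAt 𝕜 s x) :
    extDerivWithin (fun y ↦ g y • β y) s x =
      g x • extDerivWithin β s x + wedgeOne (fderivWithin 𝕜 g s x) (β x) := by
  simp only [extDerivWithin]
  rw [fderivWithin_fun_smul hs hg hβ, alternatizeUncurryFin_add, alternatizeUncurryFin_smul]
  rfl

end Flat

/-! ### Manifold: `d(ρ • α) x = ρ x • dα x + (dρ)ₓ ∧ α x` -/

section Manifold

open Literature.NumberTheory.Transcendental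

variable {E : Type*} [NormedAddCommGroup E] [NormedSpace ℝ E]
  {H : Type*} [TopologicalSpace H] {I : ModelWithCorners ℝ E H}
  {M : Type*} [TopologicalSpace M] [ChartedSpace H M]
  {F : Type*} [NormedAddCommGroup F] [NormedSpace ℝ F] {k : ℕ}

/-- A function differentiable at `x` (in the manifold sense) is differentiable within `range I` at
the chart point when read in the chart at `x`. [folklore] -/
theorem differentiableWithinAt_comp_extChartAt_symm {ρ : M → ℝ} {x : M}
    (hρ : MDifferentiableAt I 𝓘(ℝ, ℝ) ρ x) :
    DifferentiableWithinAt ℝ (ρ ∘ (extChartAt I x).symm) (range I) (extChartAt I x x) := by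
  have h := ((mdifferentiableAt_iff ρ x).1 hρ).2
  simpa only [writtenInExtChartAt, extChartAt_model_space_eq_id, PartialEquiv.refl_coe,
    Function.id_comp] using h

/-- **Leibniz rule for a function times a form on a manifold, in the chart at the point**:
with `e = extChartAt I x` and `c = e x`,
`d((ρ • α)^e)(c) = ρ x • d(α^e)(c) + D(ρ ∘ e⁻¹)(c) ∧ α^e(c)` (`α^e = α.inChart x`, `∧ = wedgeOne`,
derivatives within `range I`). Combined with `mextDeriv_eq_extDerivWithin_of_chartedSpace`
(`dβ x = d(β^e)(c)`) and `inChart_apply_self_of_chartedSpace` (`α^e(c) = α x`) this is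
`d(ρα) = ρ dα + dρ ∧ α` at `x` (Warner (1983), Thm. 2.20 / Prop. 2.23). Hypotheses: `ρ`
differentiable at `x`, `α` smooth at `x`. [cite: WarnerGTM94, Thm. 2.20] -/
theorem extDerivWithin_inChart_fun_smul {ρ : M → ℝ} {α : MForm I M F k} {x : M}
    (hρ : MDifferentiableAt I 𝓘(ℝ, ℝ) ρ x) (hα : α.SmoothAt x) :
    extDerivWithin ((ρ • α).inChart x) (range I) (extChartAt I x x) =
      ρ x • extDerivWithin (α.inChart x) (range I) (extChartAt I x x) +
        wedgeOne (fderivWithin ℝ (ρ ∘ (extChartAt I x).symm) (range I) (extChartAt I x x))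
          (α.inChart x (extChartAt I x x)) := by
  have hU : UniqueDiffWithinAt ℝ (range I) (extChartAt I x x) :=
    I.uniqueDiffOn _ (extChartAt_target_subset_range x (mem_extChartAt_target x))
  have hx : ρ ((extChartAt I x).symm (extChartAt I x x)) = ρ x := by rw [extChartAt_to_inv]
  rw [MForm.inChart_fun_smul, extDerivWithin_fun_smul' (g := fun y ↦ ρ ((extChartAt I x).symm y))
    (differentiableWithinAt_comp_extChartAt_symm hρ) (hα.differentiableWithinAt (by simp)) hU, hx]
  rfl

/-- **Leibniz rule for a function times a form on a manifold, at a point**: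
`d(ρ • α) x = ρ x • dα x + (dρ)ₓ ∧ α x`, the last term being the form whose value at `x'` is
`wedgeOne (D(ρ ∘ e_{x'}⁻¹)(e_{x'} x')) (α x')` (differential of `ρ` read in the chart at `x'`,
wedged in the convention of Mathlib's `extDeriv`). Warner (1983), Thm. 2.20 / Prop. 2.23.
[cite: WarnerGTM94, Thm. 2.20] -/
theorem mextDeriv_fun_smul_apply {ρ : M → ℝ} {α : MForm I M F k} {x : M}
    (hρ : MDifferentiableAt I 𝓘(ℝ, ℝ) ρ x) (hα : α.SmoothAt x) (v : Fin (k + 1) → TangentSpace I x) :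
    mextDeriv (ρ • α) x v = ρ x • mextDeriv α x v +
      wedgeOne (fderivWithin ℝ (ρ ∘ (extChartAt I x).symm) (range I) (extChartAt I x x))
        (show E [⋀^Fin k]→L[ℝ] F from α x) v := by
  have h := congrArg (fun w : E [⋀^Fin (k + 1)]→L[ℝ] F ↦ w v)
    ((mextDeriv_eq_extDerivWithin_of_chartedSpace (ρ • α) x).trans
      (extDerivWithin_inChart_fun_smul hρ hα))
  simp only [ContinuousAlternatingMap.add_apply, inChart_apply_self_of_chartedSpace,
    ← mextDeriv_eq_extDerivWithin_of_chartedSpace] at h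
  exact h

/-- **A smooth function times a smooth form is smooth** (any coefficients). [folklore] -/
theorem IsSmoothForm.fun_smul' {ρ : M → ℝ} (hρ : ContMDiff I 𝓘(ℝ) ∞ ρ) {α : MForm I M F k}
    (hα : IsSmoothForm α) : IsSmoothForm (ρ • α) :=
  fun x ↦ MForm.SmoothAt.fun_smul (hρ x) (hα x)

end Manifold

end Literature.Geometry.Kaehler
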